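import Literature.AlgebraicGeometry.AbelianSchemes.IsogenyOfFiniteKernelOnPoints   -- ★ «the roof legs are isogenies» (+ ★ `DualIsogenyDegree`)
import Literature.AlgebraicGeometry.AbelianSchemes.DualPairDimEq                   -- ★ `DualPair.dim_hat_eq`
import Literature.AlgebraicGeometry.AbelianSchemes.PolarizationUnitHypothesis      -- ★ `Polarization.nonempty_unitHatSlice_iso`
import Literature.AlgebraicGeometry.Motives.AbelianVarietyIsogenyEtale             -- ★ `IsIsogeny.natCard_kerPoints_eq_kerRank_of_charZero`
import Literature.AlgebraicGeometry.Motives.AbelianVarietyIsogenyPairFlip          -- ★ `isIsogeny_of_comp_eq_nsmul_id`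
import Literature.AlgebraicGeometry.Motives.AbelianVarietyIsogenyDescent           -- ★ `isIsogeny_of_isIsogeny_comp_eq`
import Literature.AlgebraicGeometry.AbelianSchemes.DualIsogenyDegreeEq             -- ★ (B2) `DualPair.kerRank_dualHom_eq` (ED. 3)
import Mathlib.GroupTheory.Perm.Cycle.Type                                         -- Cauchy `exists_prime_orderOf_dvd_card'`
import HarnessLib

/-!
# The ROOF DEGREE IDENTITY `deg q² · deg λ″ = deg c² · deg λ` of an isogeny roof `A —q→ B ←c— A″`, and the three-roof count
# ([MumfordAV1970] §15 Thm. 1, §19, §23; [GortzWedhorn2023] Prop. 27.186, Prop. 27.213 (3); [Liu2021] Prop. D.8)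

Topic `AlgebraicGeometry/AbelianSchemes`; namespace `Literature.AlgebraicGeometry.AbelianSchemes.AbelianSchemeOver`.  THEOREMS ONLY (no definition, no
named fact, no `instance`, no notation, no `sorry`).  Cell `hodgecm-mathlib` (D-0151), F0∕P6 «MOD», «GO 500» line L2 (socket `stub_DOWN`), organ **(ρ2‴)
«ROOF DEGREE CHAIN»** (LA2-p03 (g2), 2026-09-02): the DEGREE CLAUSE `hdeg : #K = #A″[𝔭_w](Ω̄)` of ★ (ρ2″) `RoofKernelIdealTorsion.isIdealTorsion_mul_of_roof`
and the rank row `hrk` of the (BLK) assembly, derived from the roofs the datum already serves, WITHOUT a spine token and WITHOUT the `ℓ`-chain.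
`--supports stmt-HodgeConjecture-24832`, count-neutral.  HC_CM is proved only modulo the cell's printed citations (2 remaining named inputs: hLiu418
= stmt-HodgeConjecture-24832, h413 = stmt-HodgeConjecture-24833) until rung 0 closes; this file discharges none of them.

THE MATHEMATICS.  An isogeny roof over an algebraically closed field `Ω` of characteristic `0`: homomorphisms `q : A → B`, `c : A″ → B` of abelian
`Ω`-schemes of one dimension `g`, `c` surjective, a homomorphism `λ_B : B → B̂`, polarisations `λ : A → Â`, `λ″ : A″ → Â″` with `p`-prime quasi-inverses
((P-1) `λ ≫ ν = [d]`, `p ∤ d`), and the two similitude equations (r3) `q ≫ λ_B ≫ q^∨ = λ ≫ [p]`, `c ≫ λ_B ≫ c^∨ = λ″ ≫ [p]`.  Then `q`, `c`, `λ`, `λ″`,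
`λ_B` are isogenies (★ `IsogenyOfFiniteKernelOnPoints`, ★ `isIsogeny_of_comp_eq_nsmul_id`, ★ `isIsogeny_of_isIsogeny_comp_eq`, `dim B̂ = dim B` ★
`DualPair.dim_hat_eq`), and the CHAIN DEGREE LAW ★ `DualIsogenyDegree.kerRank_mul_mul_kerRank_dualHom_eq` ([MumfordAV1970] §19, [GortzWedhorn2023] Prop.
27.186) reads `deg q · deg λ_B · deg q^∨ = p^{2g} · deg λ` and `deg c · deg λ_B · deg c^∨ = p^{2g} · deg λ″`.  GIVEN the degree clause of [GortzWedhorn2023]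
Prop. 27.213 (3) ∕ [MumfordAV1970] §15 Thm. 1 «`deg ψ^∨ = deg ψ`» FOR THE TWO LEGS — taken here as the two HYPOTHESES `hqd`, `hcd` in exactly the body
shape of the tree's named fact ★ `GortzWedhorn2023.Ch27DualityRows.Prop_27_213_3_deg` (to be fed by its discharge over `Ω̄`, organ (B2), or by the fact
itself) — the terms `deg λ_B` and `p^{2g}` cancel: **`deg q² · deg λ″ = deg c² · deg λ`** (§1, `kerRank` currency; §2, `Ω̄`-points currency, all isogenies
being étale in characteristic `0`, ★ `IsIsogeny.natCard_kerPoints_eq_kerRank_of_charZero`).  §3 is the ℕ-ARITHMETIC of three such identities along the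
roofs `y → y″ → y‴` and `y → y‴` of the moduli datum ([Liu2021] Prop. D.8: the two-step Hecke translate is the central translate; kernels `K`, `K″` and
`K₂ = A_y[𝔭_{c•w}]` with `#K₂ = #Ker c_i = Q = q²`, all `#Ker λ` prime to `p` by (P-1), §4): `a₁²ℓ″ = Q²ℓ`, `a₂²ℓ‴ = Q²ℓ″`, `Q²ℓ‴ = Q²ℓ` force
`a₁ = a₂ = Q`, i.e. `#K = q²` — the degree clause.

## Contents
* §1 `kerRank_sq_mul_eq_of_roof` — the identity in `Hom.kerRank` currency over any field, for isogenies.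
* §2 (`Ω = Ω̄`, char `0`) `isIsogeny_lam_of_quasiInverse` ((P-1) ⇒ `λ` is an isogeny), `finite_setOf_map_eq_one_of_roofLeg` (the kernel points of a leg are
  finite), `roof_isogenies` (`q`, `c`, `λ_B` are isogenies), `natCard_setOf_map_eq_one_eq_kerRank` (points ↔ `kerRank`), and the head
  **`natCard_ker_sq_mul_eq_of_roof`** — the identity in the `AlgPoints.map` currency of ★ (ρ2″) ∕ `RoofΩ`, binders token for token those of ★
  `isIdealTorsion_mul_of_roof` (`q c lamB D pol D″ pol″ DB hDB h2s h3 h3″ hν`) plus `hν″`, `hA`, `hA″` and the two (B2)-shaped equalities; `…_of_iff_mem` — the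
  same with (r1)∕(r2)-style membership descriptions of the two kernels.
* §3 `eq_of_three_roof_identities` — the ℕ-lemma.
* §4 `coprime_natCard_setOf_map_lam_eq_one` — `p ∤ #Ker λ(Ω̄)` from (P-1).
* (ED. 2) §5 `natCard_setOf_map_lam_eq_one_pos` (`0 < #Ker λ(Ω)`) and the THREE-ROOF HEAD **`natCard_eq_of_three_roofs`**: three roofs `A₁ → B₁ ← A₂`,
  `A₂ → B₂ ← A₃`, `A₁ → B₃ ← A₃` in the binder shapes of `natCard_sq_mul_eq_of_roof_of_iff_mem`, the `c`-kernel counts and `#K₂` all `= Q = p^k` ⇒ `#K = Q`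
  — the leaf's `hdeg`∕`hrk` in ONE application (the two-step Hecke translate `y‴ = quotΩ y″ L′ = translΩ y` makes roof₂'s and roof₃'s far object the SAME `A₃`).
* (ED. 3) §6 the (B2)-FED forms: `kerRank_dualHom_eq_of_roof` (the two degree clauses of a roof's legs, ★ `DualPair.kerRank_dualHom_eq` on `roof_isogenies`) and
  **`natCard_eq_of_three_roofs'`** — `natCard_eq_of_three_roofs` with the six `kerRank` binders DISCHARGED (characteristic `0`, `Ω = Ω̄`).

## References
* [MumfordAV1970] D. Mumford, *Abelian Varieties* (1970), §15 Thm. 1 (p. 143), §19 Thm. 1 and Remark (pp. 169–174), §23 Thm. 2 (p. 231).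
* [Shimura1998] G. Shimura, *Abelian varieties with complex multiplication and modular functions* (1998), §7.5 (p. 72).
* [GortzWedhorn2023] U. Görtz, T. Wedhorn, *Algebraic Geometry II* (2023), Prop. 27.176, Cor. 27.177, Prop. 27.186, Prop. 27.190, Prop. 27.213 (3).
* [Liu2021] Y. Liu, *Fourier–Jacobi cycles and arithmetic relative trace formula*, Camb. J. Math. 9 (2021), App. D, Prop. D.8 (pp. 135–138).
-/

set_option autoImplicit false

noncomputable section

set_option backward.isDefEq.respectTransparency false

universe u

open CategoryTheory CategoryTheory.Limits AlgebraicGeometry MonoidalCategory CartesianMonoidalCategory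
open scoped MonObj
open Literature.AlgebraicGeometry.Motives (AlgPoints SchemeOver specOver)
open Literature.AlgebraicGeometry.Motives.AbelianVariety

namespace Literature.AlgebraicGeometry.AbelianSchemes

namespace AbelianSchemeOver

/-! ## §1 The identity in `kerRank` currency -/

section KerRank

variable {k : Type u} [Field k] {A A'' B : AbelianSchemeOver (Spec (.of k))}

set_option maxHeartbeats 400000 in
/-- **THE ROOF DEGREE IDENTITY, `kerRank` currency.**  For isogenies `q : A → B`, `c : A″ → B`, `λ : A → Â`, `λ″ : A″ → Â″`, `λ_B : B → B̂` of abelian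
`k`-schemes of one dimension (`hdim`) with the two similitude equations `q ≫ λ_B ≫ q^∨ = λ ≫ [p]`, `c ≫ λ_B ≫ c^∨ = λ″ ≫ [p]` (`p ≠ 0`), and GIVEN
`deg q^∨ = deg q`, `deg c^∨ = deg c` ([GortzWedhorn2023] Prop. 27.213 (3), the body of ★ `Prop_27_213_3_deg` for the two legs):
`deg q ^ 2 · deg λ″ = deg c ^ 2 · deg λ` — the chain degree law ★ `kerRank_mul_mul_kerRank_dualHom_eq` for both legs, `deg λ_B · p^{2g}` cancelled.
[cite: MumfordAV1970, §15 Thm. 1 (p. 143); §19 Remark p. 169] [cite: GortzWedhorn2023, Prop. 27.186 and Prop. 27.213 (3)] -/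
theorem kerRank_sq_mul_eq_of_roof (q : A.X ⟶ B.X) [IsMonHom q] (c : A''.X ⟶ B.X) [IsMonHom c]
    (D : A.DualPair) (D'' : A''.DualPair) (DB : B.DualPair)
    (hD : Nonempty ((Scheme.Modules.pullback D.unitHatSlice).obj D.P ≅ SheafOfModules.unit _))
    (hD'' : Nonempty ((Scheme.Modules.pullback D''.unitHatSlice).obj D''.P ≅ SheafOfModules.unit _))
    (hDB : Nonempty ((Scheme.Modules.pullback DB.unitHatSlice).obj DB.P ≅ SheafOfModules.unit _))
    (lam : A.X ⟶ D.hat.X) [IsMonHom lam] (lam'' : A''.X ⟶ D''.hat.X) [IsMonHom lam''] (lamB : B.X ⟶ DB.hat.X) [IsMonHom lamB]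
    (hq : IsIsogeny (homOfIsMonHom q)) (hc : IsIsogeny (homOfIsMonHom c))
    (hlam : IsIsogeny (homOfIsMonHom lam)) (hlam'' : IsIsogeny (homOfIsMonHom lam'')) (hlamB : IsIsogeny (homOfIsMonHom lamB))
    {p : ℕ} (hp : p ≠ 0)
    (h3 : q ≫ lamB ≫ DualPair.dualIsogenyOver q D DB = lam ≫ D.hat.mulN p)
    (h3'' : c ≫ lamB ≫ DualPair.dualIsogenyOver c D'' DB = lam'' ≫ D''.hat.mulN p)
    (hdim : A.toAffine.toAbelianVariety.dim = A''.toAffine.toAbelianVariety.dim)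
    (hqd : Hom.kerRank (DualPair.dualHom q D DB hD hDB) = Hom.kerRank (homOfIsMonHom q))
    (hcd : Hom.kerRank (DualPair.dualHom c D'' DB hD'' hDB) = Hom.kerRank (homOfIsMonHom c)) :
    Hom.kerRank (homOfIsMonHom q) ^ 2 * Hom.kerRank (homOfIsMonHom lam'') =
      Hom.kerRank (homOfIsMonHom c) ^ 2 * Hom.kerRank (homOfIsMonHom lam) := by
  have E1 := DualPair.kerRank_mul_mul_kerRank_dualHom_eq q D DB hD hDB hq lam lamB hlam hlamB hp h3
  have E2 := DualPair.kerRank_mul_mul_kerRank_dualHom_eq c D'' DB hD'' hDB hc lam'' lamB hlam'' hlamB hp h3''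
  rw [hqd] at E1
  rw [hcd, ← hdim] at E2
  -- cancel `deg λ_B · p^{2 dim A}`
  have hpos : 0 < Hom.kerRank (homOfIsMonHom lamB) * p ^ (2 * A.toAffine.toAbelianVariety.dim) := by
    haveI := hlamB.2
    exact Nat.mul_pos (Hom.kerRank_pos _) (pow_pos (Nat.pos_of_ne_zero hp) _)
  have key : Hom.kerRank (homOfIsMonHom q) ^ 2 * Hom.kerRank (homOfIsMonHom lam'') *
        (Hom.kerRank (homOfIsMonHom lamB) * p ^ (2 * A.toAffine.toAbelianVariety.dim)) =
      Hom.kerRank (homOfIsMonHom c) ^ 2 * Hom.kerRank (homOfIsMonHom lam) *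
        (Hom.kerRank (homOfIsMonHom lamB) * p ^ (2 * A.toAffine.toAbelianVariety.dim)) := by
    calc Hom.kerRank (homOfIsMonHom q) ^ 2 * Hom.kerRank (homOfIsMonHom lam'') *
          (Hom.kerRank (homOfIsMonHom lamB) * p ^ (2 * A.toAffine.toAbelianVariety.dim))
        = (Hom.kerRank (homOfIsMonHom q) * Hom.kerRank (homOfIsMonHom lamB) * Hom.kerRank (homOfIsMonHom q)) *
            (p ^ (2 * A.toAffine.toAbelianVariety.dim) * Hom.kerRank (homOfIsMonHom lam'')) := by ring
      _ = (p ^ (2 * A.toAffine.toAbelianVariety.dim) * Hom.kerRank (homOfIsMonHom lam)) *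
            (Hom.kerRank (homOfIsMonHom c) * Hom.kerRank (homOfIsMonHom lamB) * Hom.kerRank (homOfIsMonHom c)) := by rw [E1, ← E2]
      _ = Hom.kerRank (homOfIsMonHom c) ^ 2 * Hom.kerRank (homOfIsMonHom lam) *
          (Hom.kerRank (homOfIsMonHom lamB) * p ^ (2 * A.toAffine.toAbelianVariety.dim)) := by ring
  exact Nat.eq_of_mul_eq_mul_right hpos key

end KerRank

/-! ## §2 Over any field: the polarisation map is an isogeny, the kernel points of a leg are finite, `p ∤ #Ker λ` -/

section AnyField

variable {Ω : Type u} [Field Ω] {A A'' B : AbelianSchemeOver (Spec (.of Ω))}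

/-- **(P-1) ⇒ the polarisation map is an isogeny**: `λ ≫ ν = [d]` with `d ≠ 0` in `Ω` and `dim Â = dim A` (★ `DualPair.dim_hat_eq`) make `λ` finite and
surjective (★ `isIsogeny_of_comp_eq_nsmul_id`). [cite: MumfordAV1970, §19 Remark p. 169; §13 Cor. 3 (p. 130)] [cite: GortzWedhorn2023, Cor. 27.177 (2)] -/
theorem isIsogeny_lam_of_quasiInverse (D : A.DualPair) (lam : A.X ⟶ D.hat.X) [IsMonHom lam]
    {d : ℕ} (hd : (d : Ω) ≠ 0) (ν : D.hat.X ⟶ A.X) [IsMonHom ν] (hν : lam ≫ ν = A.mulN d) :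
    IsIsogeny (homOfIsMonHom lam) := by
  haveI : IsCommMonObj A.X := A.isCommMonObj_of_isReduced_base
  haveI := A.isMonHom_mulN d
  have huv : homOfIsMonHom lam ≫ homOfIsMonHom ν = d • 𝟙 A.toAffine.toAbelianVariety := by
    rw [← homOfIsMonHom_comp, ← natCast_zsmul, ← homOfIsMonHom_mulN A d]
    exact Literature.AlgebraicGeometry.Motives.AbelianVariety.hom_ext _ _ hν
  exact isIsogeny_of_comp_eq_nsmul_id hd huv
    (DualPair.dim_hat_eq A.toAffine.toAbelianVariety (D : (AbelianScheme.ofAbelianVariety A.toAffine.toAbelianVariety).toOver.DualPair)).symm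

/-- **The kernel points of a roof leg are finite**: if `ψ ≫ χ = λ ≫ [p]` for some `χ` and `λ ≫ ν = [d]`, then every `Ω`-point `P` with `ψ(P) = 1` satisfies
`P^{d·p} = 1`, so there are finitely many (★ `finite_setOf_map_eq_one_of_pow_eq_one`; `d p ≠ 0`). [cite: MumfordAV1970, §6 Application 3 (Proposition p. 64)] -/
theorem finite_setOf_map_eq_one_of_roofLeg (ψ : A.X ⟶ B.X) (D : A.DualPair) (lam : A.X ⟶ D.hat.X) [IsMonHom lam]
    (χ : B.X ⟶ D.hat.X) [IsMonHom χ] {p d : ℕ} (hp : p ≠ 0) (hd0 : d ≠ 0)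
    (h3 : ψ ≫ χ = lam ≫ D.hat.mulN p) (ν : D.hat.X ⟶ A.X) [IsMonHom ν] (hν : lam ≫ ν = A.mulN d) :
    {P : A.toAffine.toAbelianVariety.Points Ω | (AlgPoints.map ψ P : B.toAffine.toAbelianVariety.Points Ω) = 1}.Finite := by
  refine finite_setOf_map_eq_one_of_pow_eq_one ψ (d * p) (Nat.mul_ne_zero hd0 hp) fun P hP => ?_
  have hP' : P ≫ ψ = 1 := hP
  have hlp : (P ≫ lam) ^ p = 1 := by
    have e : P ≫ lam ≫ D.hat.mulN p = 1 := by rw [← h3, ← Category.assoc, hP', MonObj.one_comp]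
    rwa [mulN_def, MonObj.comp_pow, Category.comp_id, MonObj.comp_pow] at e
  have e2 : P ≫ lam ≫ ν = P ^ d := by
    rw [hν, mulN_def, MonObj.comp_pow]
    exact congrArg (· ^ d) (Category.comp_id P)
  rw [pow_mul, ← e2, ← Category.assoc, ← MonObj.pow_comp, hlp, MonObj.one_comp]

/-! ## §2b `p ∤ #Ker λ(Ω)` from (P-1) -/

/-- **(P-1) ⇒ `p ∤ #Ker λ(Ω)`**: if `λ ≫ ν = [d]` with `p ∤ d`, every `Ω`-point `P` with `λ(P) = 1` satisfies `P^d = 1`; were `p` to divide the (finite) number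
of such points, Cauchy's theorem (Mathlib `exists_prime_orderOf_dvd_card'`) would give one of order `p`, so `p ∣ d`.  [cite: MumfordAV1970, §6 Application 3
(Proposition p. 64); §19 Remark p. 169] -/
theorem coprime_natCard_setOf_map_lam_eq_one (D : A.DualPair) (lam : A.X ⟶ D.hat.X) [IsMonHom lam] {p : ℕ} (hp : p.Prime)
    {d : ℕ} (hcop : p.Coprime d) (ν : D.hat.X ⟶ A.X) [IsMonHom ν] (hν : lam ≫ ν = A.mulN d) :
    p.Coprime (Nat.card {P : A.toAffine.toAbelianVariety.Points Ω // (AlgPoints.map lam P : D.hat.toAffine.toAbelianVariety.Points Ω) = 1}) := by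
  haveI : Fact p.Prime := ⟨hp⟩
  have hd0 : d ≠ 0 := by rintro rfl; exact hp.ne_one ((Nat.coprime_zero_right p).mp hcop)
  -- the kernel points as a subgroup, all of them `d`-torsion
  have htor : ∀ P : A.toAffine.toAbelianVariety.Points Ω,
      (AlgPoints.map lam P : D.hat.toAffine.toAbelianVariety.Points Ω) = 1 → P ^ d = 1 := by
    intro P hP
    have hP' : P ≫ lam = 1 := hP
    have e2 : P ≫ lam ≫ ν = P ^ d := by
      rw [hν, mulN_def, MonObj.comp_pow]
      exact congrArg (· ^ d) (Category.comp_id P)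
    rw [← e2, ← Category.assoc, hP', MonObj.one_comp]
  haveI hfin : Finite {P : A.toAffine.toAbelianVariety.Points Ω // (AlgPoints.map lam P : D.hat.toAffine.toAbelianVariety.Points Ω) = 1} :=
    (finite_setOf_map_eq_one_of_pow_eq_one lam d hd0 htor).to_subtype
  have e : {P : A.toAffine.toAbelianVariety.Points Ω // (AlgPoints.map lam P : D.hat.toAffine.toAbelianVariety.Points Ω) = 1} ≃
      ↥(Hom.kerPoints (specOver Ω Ω) (homOfIsMonHom lam)) :=
    Equiv.subtypeEquivRight fun P => by rw [Hom.mem_kerPoints_iff]; rfl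
  haveI : Finite ↥(Hom.kerPoints (specOver Ω Ω) (homOfIsMonHom lam)) := Finite.of_equiv _ e
  have hcard : Nat.card {P : A.toAffine.toAbelianVariety.Points Ω // (AlgPoints.map lam P : D.hat.toAffine.toAbelianVariety.Points Ω) = 1} =
      Nat.card ↥(Hom.kerPoints (specOver Ω Ω) (homOfIsMonHom lam)) :=
    Nat.card_congr e
  rw [hcard, Nat.Prime.coprime_iff_not_dvd hp]
  intro hdvd
  obtain ⟨x, hx⟩ := exists_prime_orderOf_dvd_card' p hdvd
  have hx1 : (x : A.toAffine.toAbelianVariety.Points Ω) ^ d = 1 := htor x.1 x.2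
  have hxd : x ^ d = 1 := Subtype.ext (by simpa only [Subgroup.coe_pow, Subgroup.coe_one] using hx1)
  have : p ∣ d := by rw [← hx]; exact orderOf_dvd_of_pow_eq_one hxd
  exact (Nat.Prime.coprime_iff_not_dvd hp).mp hcop this

end AnyField

/-! ## §3 The identity on `Ω̄`-points (`Ω` algebraically closed of characteristic `0`) -/

section AlgClosed

variable {Ω : Type u} [Field Ω] [IsAlgClosed Ω] {A A'' B : AbelianSchemeOver (Spec (.of Ω))}

/-- **The `Ω̄`-points count of the kernel of an isogeny is its degree** in characteristic `0` (every isogeny is étale, ★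
`IsIsogeny.natCard_kerPoints_eq_kerRank_of_charZero`), in the `AlgPoints.map` spelling of the datum. [cite: MumfordAV1970, §7 Thm. 4 (p. 72)]
[cite: GortzWedhorn2023, Prop. 27.176] -/
theorem natCard_setOf_map_eq_one_eq_kerRank [CharZero Ω] (ψ : A.X ⟶ B.X) [IsMonHom ψ] (hψ : IsIsogeny (homOfIsMonHom ψ)) :
    Nat.card {P : A.toAffine.toAbelianVariety.Points Ω // (AlgPoints.map ψ P : B.toAffine.toAbelianVariety.Points Ω) = 1} =
      Hom.kerRank (homOfIsMonHom ψ) := by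
  rw [← hψ.natCard_kerPoints_eq_kerRank_of_charZero Ω]
  exact Nat.card_congr (Equiv.subtypeEquivRight fun P => by rw [Hom.mem_kerPoints_iff]; rfl)

set_option maxHeartbeats 400000 in
/-- **THE LEGS AND THE MIDDLE POLARISATION MAP OF A ROOF ARE ISOGENIES** (`Ω = Ω̄`, any characteristic with `(d : Ω) ≠ 0`): for `q : A → B`, `c : A″ → B` with
`c` surjective, `dim A = dim A″ = g`, (r3) `q ≫ λ_B ≫ q^∨ = λ ≫ [p]`, `c ≫ λ_B ≫ c^∨ = λ″ ≫ [p]` and (P-1) quasi-inverses of `λ`, `λ″`: `q`, `c`, `λ`, `λ″`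
AND `λ_B` are isogenies — the kernels of the legs are finite (§2 `finite_setOf_map_eq_one_of_roofLeg`), so ★ `roof_legs_isFinite_surjective_of_isOfRelDim`
applies; `λ_B ≫ q^∨` is a factor of the isogeny `λ ≫ [p]` through the isogeny `q` (★ `isIsogeny_of_isIsogeny_comp_eq`), so `λ_B` is finite (Mathlib
`IsFinite.of_comp`, `q^∨` separated) between abelian varieties of the same dimension (★ `dim_hat_eq`), hence an isogeny (★ `IsIsogeny.of_isFinite`).
[cite: MumfordAV1970, §19 Thm. 1 (p. 174) and Remark p. 169] [cite: GortzWedhorn2023, Prop. 27.176, Cor. 27.177] -/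
theorem roof_isogenies {g : ℕ} (hA : A.IsOfRelDim g) (hA'' : A''.IsOfRelDim g)
    (q : A.X ⟶ B.X) [IsMonHom q] (c : A''.X ⟶ B.X) [IsMonHom c]
    (D : A.DualPair) (D'' : A''.DualPair) (DB : B.DualPair)
    (hD : Nonempty ((Scheme.Modules.pullback D.unitHatSlice).obj D.P ≅ SheafOfModules.unit _))
    (hD'' : Nonempty ((Scheme.Modules.pullback D''.unitHatSlice).obj D''.P ≅ SheafOfModules.unit _))
    (hDB : Nonempty ((Scheme.Modules.pullback DB.unitHatSlice).obj DB.P ≅ SheafOfModules.unit _))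
    (lam : A.X ⟶ D.hat.X) [IsMonHom lam] (lam'' : A''.X ⟶ D''.hat.X) [IsMonHom lam''] (lamB : B.X ⟶ DB.hat.X) [IsMonHom lamB]
    {p : ℕ} (hp : p ≠ 0) (h2s : Function.Surjective c.left.base)
    (h3 : q ≫ lamB ≫ DualPair.dualIsogenyOver q D DB = lam ≫ D.hat.mulN p)
    (h3'' : c ≫ lamB ≫ DualPair.dualIsogenyOver c D'' DB = lam'' ≫ D''.hat.mulN p)
    {d : ℕ} (hd : (d : Ω) ≠ 0) (ν : D.hat.X ⟶ A.X) [IsMonHom ν] (hν : lam ≫ ν = A.mulN d)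
    {d'' : ℕ} (hd'' : (d'' : Ω) ≠ 0) (ν'' : D''.hat.X ⟶ A''.X) [IsMonHom ν''] (hν'' : lam'' ≫ ν'' = A''.mulN d'') :
    IsIsogeny (homOfIsMonHom q) ∧ IsIsogeny (homOfIsMonHom c) ∧ IsIsogeny (homOfIsMonHom lam) ∧ IsIsogeny (homOfIsMonHom lam'') ∧
      IsIsogeny (homOfIsMonHom lamB) := by
  haveI : IsCommMonObj A.X := A.isCommMonObj_of_isReduced_base
  haveI : IsCommMonObj D.hat.X := D.hat.isCommMonObj_of_isReduced_base
  haveI := D.hat.isMonHom_mulN p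
  haveI hqd : IsMonHom (DualPair.dualIsogenyOver q D DB) := DualPair.isMonHom_dualIsogenyOver q D DB hDB hD
  haveI hcd : IsMonHom (DualPair.dualIsogenyOver c D'' DB) := DualPair.isMonHom_dualIsogenyOver c D'' DB hDB hD''
  have hd0 : d ≠ 0 := by rintro rfl; exact hd Nat.cast_zero
  have hd0'' : d'' ≠ 0 := by rintro rfl; exact hd'' Nat.cast_zero
  have hlam := isIsogeny_lam_of_quasiInverse D lam hd ν hν
  have hlam'' := isIsogeny_lam_of_quasiInverse D'' lam'' hd'' ν'' hν''
  -- the legs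
  have hqfin := finite_setOf_map_eq_one_of_roofLeg q D lam (lamB ≫ DualPair.dualIsogenyOver q D DB) hp hd0 h3 ν hν
  have hcfin := finite_setOf_map_eq_one_of_roofLeg c D'' lam'' (lamB ≫ DualPair.dualIsogenyOver c D'' DB) hp hd0'' h3'' ν'' hν''
  obtain ⟨hqs, hqf, hcs, hcf⟩ := roof_legs_isFinite_surjective_of_isOfRelDim hA hA'' q c h2s hqfin hcfin
  have hq : IsIsogeny (homOfIsMonHom q) := ⟨hqs, hqf⟩
  have hc : IsIsogeny (homOfIsMonHom c) := ⟨hcs, hcf⟩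
  -- the middle map: `λ_B ≫ q^∨` is an isogeny, then `λ_B`
  have hX : IsIsogeny (homOfIsMonHom lamB ≫ DualPair.dualHom q D DB hD hDB) := by
    refine isIsogeny_of_isIsogeny_comp_eq hq (isIsogeny_comp hlam (isIsogeny_zsmul_id_holds _ (p : ℤ) (Int.natCast_ne_zero.mpr hp))) ?_
    rw [← homOfIsMonHom_mulN, ← homOfIsMonHom_comp, DualPair.dualHom, ← homOfIsMonHom_comp, ← homOfIsMonHom_comp]
    exact Literature.AlgebraicGeometry.Motives.AbelianVariety.hom_ext _ _ h3
  have hlamB : IsIsogeny (homOfIsMonHom lamB) := by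
    have hfin : IsFinite (Hom.toSchemeHom (homOfIsMonHom lamB) ≫ Hom.toSchemeHom (DualPair.dualHom q D DB hD hDB)) := by
      rw [← toSchemeHom_comp]
      exact hX.2
    have hsep : IsSeparated (Hom.toSchemeHom (DualPair.dualHom q D DB hD hDB)) := by
      have : IsSeparated (Hom.toSchemeHom (DualPair.dualHom q D DB hD hDB) ≫ D.hat.toAffine.toAbelianVariety.X.hom) := by
        rw [toSchemeHom_comp_hom]
        infer_instance
      exact IsSeparated.of_comp (Hom.toSchemeHom (DualPair.dualHom q D DB hD hDB)) D.hat.toAffine.toAbelianVariety.X.hom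
    haveI : IsFinite (Hom.toSchemeHom (homOfIsMonHom lamB)) := IsFinite.of_comp _ (Hom.toSchemeHom (DualPair.dualHom q D DB hD hDB))
    exact IsIsogeny.of_isFinite _
      (DualPair.dim_hat_eq B.toAffine.toAbelianVariety (DB : (AbelianScheme.ofAbelianVariety B.toAffine.toAbelianVariety).toOver.DualPair)).symm
  exact ⟨hq, hc, hlam, hlam'', hlamB⟩

set_option maxHeartbeats 400000 in
/-- **THE ROOF DEGREE IDENTITY ON `Ω̄`-POINTS** (`Ω = Ω̄`, characteristic `0`), binders in the token shapes of ★ (ρ2″) `isIdealTorsion_mul_of_roof` ∕ the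
datum's `RoofΩ`: for the roof `A —q→ B ←c— A″` of abelian `Ω`-schemes of relative dimension `g` with polarisations `pol`, `pol″`, the middle map `lamB`,
(r2) `c` surjective, (r3) both similitude equations at level `p`, (P-1) `p`-prime quasi-inverses of `λ = pol.lam`, `λ″ = pol″.lam`, and GIVEN the two degree
clauses `deg q^∨ = deg q`, `deg c^∨ = deg c` ([GortzWedhorn2023] Prop. 27.213 (3) — the body of ★ `Prop_27_213_3_deg` at `q` and at `c`):
`#Ker q(Ω)² · #Ker λ″(Ω) = #Ker c(Ω)² · #Ker λ(Ω)`.  So `#Ker q(Ω) = #Ker c(Ω)` EXACTLY WHEN `#Ker λ(Ω) = #Ker λ″(Ω)` (§3 supplies this along three roofs).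
[cite: MumfordAV1970, §15 Thm. 1 (p. 143); §19 Thm. 1 (p. 174); §23 Thm. 2 (p. 231)] [cite: GortzWedhorn2023, Prop. 27.186 and Prop. 27.213 (3)]
[cite: Liu2021, Prop. D.8 (pp. 135–138)] -/
theorem natCard_ker_sq_mul_eq_of_roof [CharZero Ω] {g : ℕ} (hA : A.IsOfRelDim g) (hA'' : A''.IsOfRelDim g)
    (D : A.DualPair) (pol : A.Polarization D) (D'' : A''.DualPair) (pol'' : A''.Polarization D'')
    (DB : B.DualPair) (lamB : B.X ⟶ DB.hat.X) [IsMonHom lamB]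
    (hDB : Nonempty ((Scheme.Modules.pullback DB.unitHatSlice).obj DB.P ≅ SheafOfModules.unit _))
    (q : A.X ⟶ B.X) [IsMonHom q] (c : A''.X ⟶ B.X) [IsMonHom c] {p : ℕ} (hp : p.Prime)
    (h2s : Function.Surjective c.left.base)
    (h3 : q ≫ lamB ≫ DualPair.dualIsogenyOver q D DB = pol.lam ≫ D.hat.mulN p)
    (h3'' : c ≫ lamB ≫ DualPair.dualIsogenyOver c D'' DB = pol''.lam ≫ D''.hat.mulN p)
    (hν : ∃ (d : ℕ) (ν : D.hat.X ⟶ A.X), IsMonHom ν ∧ p.Coprime d ∧ pol.lam ≫ ν = A.mulN d)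
    (hν'' : ∃ (d : ℕ) (ν : D''.hat.X ⟶ A''.X), IsMonHom ν ∧ p.Coprime d ∧ pol''.lam ≫ ν = A''.mulN d)
    (hqd : Hom.kerRank (DualPair.dualHom q D DB pol.nonempty_unitHatSlice_iso hDB) = Hom.kerRank (homOfIsMonHom q))
    (hcd : Hom.kerRank (DualPair.dualHom c D'' DB pol''.nonempty_unitHatSlice_iso hDB) = Hom.kerRank (homOfIsMonHom c)) :
    Nat.card {P : A.toAffine.toAbelianVariety.Points Ω // (AlgPoints.map q P : B.toAffine.toAbelianVariety.Points Ω) = 1} ^ 2 *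
      Nat.card {P : A''.toAffine.toAbelianVariety.Points Ω // (AlgPoints.map pol''.lam P : D''.hat.toAffine.toAbelianVariety.Points Ω) = 1} =
    Nat.card {P : A''.toAffine.toAbelianVariety.Points Ω // (AlgPoints.map c P : B.toAffine.toAbelianVariety.Points Ω) = 1} ^ 2 *
      Nat.card {P : A.toAffine.toAbelianVariety.Points Ω // (AlgPoints.map pol.lam P : D.hat.toAffine.toAbelianVariety.Points Ω) = 1} := by
  haveI := pol.isMonHom
  haveI := pol''.isMonHom
  obtain ⟨d, ν, hνm, hcop, hν⟩ := hν
  obtain ⟨d'', ν'', hνm'', hcop'', hν''⟩ := hν''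
  haveI := hνm
  haveI := hνm''
  have hp0 : p ≠ 0 := hp.ne_zero
  have hd0 : d ≠ 0 := by rintro rfl; exact hp.ne_one ((Nat.coprime_zero_right p).mp hcop)
  have hd0'' : d'' ≠ 0 := by rintro rfl; exact hp.ne_one ((Nat.coprime_zero_right p).mp hcop'')
  have hD := pol.nonempty_unitHatSlice_iso
  have hD'' := pol''.nonempty_unitHatSlice_iso
  obtain ⟨hq, hc, hlam, hlam'', hlamB⟩ := roof_isogenies hA hA'' q c D D'' DB hD hD''
    hDB pol.lam pol''.lam lamB hp0 h2s h3 h3'' (Nat.cast_ne_zero.mpr hd0) ν hν (Nat.cast_ne_zero.mpr hd0'') ν'' hν''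
  have hdim : A.toAffine.toAbelianVariety.dim = A''.toAffine.toAbelianVariety.dim :=
    (dim_eq_of_isIsogeny hq).trans (dim_eq_of_isIsogeny hc).symm
  have key := kerRank_sq_mul_eq_of_roof q c D D'' DB hD hD'' hDB pol.lam pol''.lam lamB
    hq hc hlam hlam'' hlamB hp0 h3 h3'' hdim hqd hcd
  rw [← natCard_setOf_map_eq_one_eq_kerRank q hq, ← natCard_setOf_map_eq_one_eq_kerRank c hc,
    ← natCard_setOf_map_eq_one_eq_kerRank pol.lam hlam, ← natCard_setOf_map_eq_one_eq_kerRank pol''.lam hlam''] at key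
  exact key

set_option maxHeartbeats 400000 in
/-- **THE ROOF DEGREE IDENTITY, membership form** — the same with the two kernels described as in (r1)∕(r2) of `RoofΩ`: `q(P) = 1 ↔ P ∈ K` for a subgroup
`K ≤ A(Ω)` and `c(P″) = 1 ↔ T P″` for any predicate `T` (e.g. `T P″ := ∀ a ∈ 𝔭_w, ι″(a)(P″) = 1`, the `𝔭_w`-torsion):
`#K² · #Ker λ″(Ω) = #{P″ | T P″}² · #Ker λ(Ω)` — the shape in which ★ (ρ2″)'s `hdeg : Nat.card ↥K = Nat.card {P″ // T P″}` is read off (§3).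
[cite: MumfordAV1970, §15 Thm. 1 (p. 143); §23 Thm. 2 (p. 231)] [cite: GortzWedhorn2023, Prop. 27.213 (3)] [cite: Liu2021, Prop. D.8 (pp. 135–138)] -/
theorem natCard_sq_mul_eq_of_roof_of_iff_mem [CharZero Ω] {g : ℕ} (hA : A.IsOfRelDim g) (hA'' : A''.IsOfRelDim g)
    (D : A.DualPair) (pol : A.Polarization D) (D'' : A''.DualPair) (pol'' : A''.Polarization D'')
    (DB : B.DualPair) (lamB : B.X ⟶ DB.hat.X) [IsMonHom lamB]
    (hDB : Nonempty ((Scheme.Modules.pullback DB.unitHatSlice).obj DB.P ≅ SheafOfModules.unit _))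
    (q : A.X ⟶ B.X) [IsMonHom q] (c : A''.X ⟶ B.X) [IsMonHom c] {p : ℕ} (hp : p.Prime)
    (K : Subgroup (A.toAffine.toAbelianVariety.Points Ω))
    (h1 : ∀ P : A.toAffine.toAbelianVariety.Points Ω, (AlgPoints.map q P : B.toAffine.toAbelianVariety.Points Ω) = 1 ↔ P ∈ K)
    (T : A''.toAffine.toAbelianVariety.Points Ω → Prop)
    (h2 : ∀ P : A''.toAffine.toAbelianVariety.Points Ω, (AlgPoints.map c P : B.toAffine.toAbelianVariety.Points Ω) = 1 ↔ T P)
    (h2s : Function.Surjective c.left.base)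
    (h3 : q ≫ lamB ≫ DualPair.dualIsogenyOver q D DB = pol.lam ≫ D.hat.mulN p)
    (h3'' : c ≫ lamB ≫ DualPair.dualIsogenyOver c D'' DB = pol''.lam ≫ D''.hat.mulN p)
    (hν : ∃ (d : ℕ) (ν : D.hat.X ⟶ A.X), IsMonHom ν ∧ p.Coprime d ∧ pol.lam ≫ ν = A.mulN d)
    (hν'' : ∃ (d : ℕ) (ν : D''.hat.X ⟶ A''.X), IsMonHom ν ∧ p.Coprime d ∧ pol''.lam ≫ ν = A''.mulN d)
    (hqd : Hom.kerRank (DualPair.dualHom q D DB pol.nonempty_unitHatSlice_iso hDB) = Hom.kerRank (homOfIsMonHom q))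
    (hcd : Hom.kerRank (DualPair.dualHom c D'' DB pol''.nonempty_unitHatSlice_iso hDB) = Hom.kerRank (homOfIsMonHom c)) :
    Nat.card ↥K ^ 2 *
      Nat.card {P : A''.toAffine.toAbelianVariety.Points Ω // (AlgPoints.map pol''.lam P : D''.hat.toAffine.toAbelianVariety.Points Ω) = 1} =
    Nat.card {P : A''.toAffine.toAbelianVariety.Points Ω // T P} ^ 2 *
      Nat.card {P : A.toAffine.toAbelianVariety.Points Ω // (AlgPoints.map pol.lam P : D.hat.toAffine.toAbelianVariety.Points Ω) = 1} := by
  have h := natCard_ker_sq_mul_eq_of_roof hA hA'' D pol D'' pol'' DB lamB hDB q c hp h2s h3 h3'' hν hν'' hqd hcd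
  have eK : Nat.card {P : A.toAffine.toAbelianVariety.Points Ω // (AlgPoints.map q P : B.toAffine.toAbelianVariety.Points Ω) = 1} = Nat.card ↥K :=
    Nat.card_congr (Equiv.subtypeEquivRight fun P => h1 P)
  have eT : Nat.card {P : A''.toAffine.toAbelianVariety.Points Ω // (AlgPoints.map c P : B.toAffine.toAbelianVariety.Points Ω) = 1} =
      Nat.card {P : A''.toAffine.toAbelianVariety.Points Ω // T P} :=
    Nat.card_congr (Equiv.subtypeEquivRight fun P => h2 P)
  rw [eK, eT] at h
  exact h

end AlgClosed

/-! ## §4 The ℕ-arithmetic of three roofs -/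

/-- **THREE ROOF IDENTITIES FORCE THE COUNT.**  If `a₁² ℓ″ = Q² ℓ`, `a₂² ℓ‴ = Q² ℓ″` and `Q² ℓ‴ = Q² ℓ` (the roof degree identities of §2 along `y → y″`,
`y″ → y‴` and `y → y‴`, the last with both kernel counts `= Q`), where `Q = p^k` is a power of the prime `p` and `ℓ`, `ℓ″` are positive and prime to `p`
(§4), then `a₁ = Q` (and `a₂ = Q`): from the three equations `(a₁a₂)² = Q⁴`; `Q² ∣ a₁² ℓ″` with `ℓ″` prime to `p` gives `Q ∣ a₁`, likewise `Q ∣ a₂`,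
and `a₁ a₂ = Q²` leaves `a₁ = a₂ = Q`.  This is the count `#K = q²` of [Liu2021] Prop. D.8 read through degrees.
[cite: Liu2021, Prop. D.8 (pp. 135–138)] [cite: MumfordAV1970, §15 Thm. 1 (p. 143)] -/
theorem eq_of_three_roof_identities {p : ℕ} (hp : p.Prime) {k Q a₁ a₂ ℓ ℓ'' ℓ''' : ℕ} (hQ : Q = p ^ k)
    (hℓ : 0 < ℓ) (hℓ'' : 0 < ℓ'') (hcop : p.Coprime ℓ) (hcop'' : p.Coprime ℓ'')
    (h₁ : a₁ ^ 2 * ℓ'' = Q ^ 2 * ℓ) (h₂ : a₂ ^ 2 * ℓ''' = Q ^ 2 * ℓ'') (h₃ : Q ^ 2 * ℓ''' = Q ^ 2 * ℓ) : a₁ = Q := by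
  have hQpos : 0 < Q := by rw [hQ]; exact pow_pos hp.pos _
  have hQ2pos : 0 < Q ^ 2 := pow_pos hQpos _
  -- `ℓ‴ = ℓ`
  have hℓ''' : ℓ''' = ℓ := Nat.eq_of_mul_eq_mul_left hQ2pos h₃
  rw [hℓ'''] at h₂
  -- `(a₁ a₂)² = Q⁴`, hence `a₁ a₂ = Q²`
  have hprod : (a₁ * a₂) ^ 2 * (ℓ * ℓ'') = (Q ^ 2) ^ 2 * (ℓ * ℓ'') := by
    calc (a₁ * a₂) ^ 2 * (ℓ * ℓ'') = (a₁ ^ 2 * ℓ'') * (a₂ ^ 2 * ℓ) := by ring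
      _ = (Q ^ 2 * ℓ) * (Q ^ 2 * ℓ'') := by rw [h₁, h₂]
      _ = (Q ^ 2) ^ 2 * (ℓ * ℓ'') := by ring
  have hprod' : (a₁ * a₂) ^ 2 = (Q ^ 2) ^ 2 := Nat.eq_of_mul_eq_mul_right (Nat.mul_pos hℓ hℓ'') hprod
  have hprod'' : a₁ * a₂ = Q ^ 2 := Nat.pow_left_injective two_ne_zero hprod'
  -- `Q ∣ a₁` and `Q ∣ a₂`
  have hdvd : ∀ {a m m' : ℕ}, p.Coprime m → a ^ 2 * m = Q ^ 2 * m' → Q ∣ a := by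
    intro a m m' hm h
    have h1 : Q ^ 2 ∣ a ^ 2 * m := ⟨m', by rw [h]⟩
    have h2 : (Q ^ 2).Coprime m := by
      rw [hQ, ← pow_mul]
      exact Nat.Coprime.pow_left _ hm
    have h3 : Q ^ 2 ∣ a ^ 2 := h2.dvd_of_dvd_mul_right h1
    exact (Nat.pow_dvd_pow_iff two_ne_zero).mp h3
  obtain ⟨u, hu⟩ := hdvd hcop'' h₁
  obtain ⟨u'', hu''⟩ := hdvd hcop h₂
  -- `u u″ = 1`
  have huu : Q ^ 2 * (u * u'') = Q ^ 2 * 1 := by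
    calc Q ^ 2 * (u * u'') = (Q * u) * (Q * u'') := by ring
      _ = Q ^ 2 * 1 := by rw [← hu, ← hu'', hprod'', mul_one]
  have huu' : u * u'' = 1 := Nat.eq_of_mul_eq_mul_left hQ2pos huu
  have hu1 : u = 1 := Nat.eq_one_of_mul_eq_one_right huu'
  rw [hu, hu1, mul_one]

/-! ## §5 (ED. 2) The three-roof head: `#K = Q` in one application -/

section ThreeRoofs

variable {Ω : Type u} [Field Ω] {A : AbelianSchemeOver (Spec (.of Ω))}

/-- **`0 < #Ker λ(Ω)`**: the kernel points of `λ` contain the unit point and are finite when `λ ≫ ν = [d]`, `d ≠ 0` (they are `d`-torsion, ★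
`finite_setOf_map_eq_one_of_pow_eq_one`). [cite: MumfordAV1970, §6 Application 3 (Proposition p. 64)] -/
theorem natCard_setOf_map_lam_eq_one_pos (D : A.DualPair) (lam : A.X ⟶ D.hat.X) [IsMonHom lam]
    {d : ℕ} (hd0 : d ≠ 0) (ν : D.hat.X ⟶ A.X) [IsMonHom ν] (hν : lam ≫ ν = A.mulN d) :
    0 < Nat.card {P : A.toAffine.toAbelianVariety.Points Ω // (AlgPoints.map lam P : D.hat.toAffine.toAbelianVariety.Points Ω) = 1} := by
  have htor : ∀ P : A.toAffine.toAbelianVariety.Points Ω,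
      (AlgPoints.map lam P : D.hat.toAffine.toAbelianVariety.Points Ω) = 1 → P ^ d = 1 := by
    intro P hP
    have hP' : P ≫ lam = 1 := hP
    have e2 : P ≫ lam ≫ ν = P ^ d := by
      rw [hν, mulN_def, MonObj.comp_pow]
      exact congrArg (· ^ d) (Category.comp_id P)
    rw [← e2, ← Category.assoc, hP', MonObj.one_comp]
  haveI : Finite {P : A.toAffine.toAbelianVariety.Points Ω // (AlgPoints.map lam P : D.hat.toAffine.toAbelianVariety.Points Ω) = 1} :=
    (finite_setOf_map_eq_one_of_pow_eq_one lam d hd0 htor).to_subtype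
  haveI : Nonempty {P : A.toAffine.toAbelianVariety.Points Ω // (AlgPoints.map lam P : D.hat.toAffine.toAbelianVariety.Points Ω) = 1} :=
    ⟨⟨1, MonObj.one_comp lam⟩⟩
  exact Nat.card_pos

end ThreeRoofs

section ThreeRoofsHead

variable {Ω : Type u} [Field Ω] [IsAlgClosed Ω] [CharZero Ω] {A₁ A₂ A₃ B₁ B₂ B₃ : AbelianSchemeOver (Spec (.of Ω))}

set_option maxHeartbeats 400000 in
/-- **THE THREE-ROOF COUNT `#K = Q`** (`Ω = Ω̄`, characteristic `0`).  Three isogeny roofs of abelian `Ω`-schemes of relative dimension `g` with polarisations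
`pol₁, pol₂, pol₃` having `p`-prime quasi-inverses ((P-1)): roof₁ `A₁ —q₁→ B₁ ←c₁— A₂` with `Ker q₁(Ω) = K` and `Ker c₁(Ω) = {T₁}`; roof₂ `A₂ —q₂→ B₂ ←c₂— A₃`
with `Ker q₂(Ω) = K″`, `Ker c₂(Ω) = {T₂}`; roof₃ `A₁ —q₃→ B₃ ←c₃— A₃` with `Ker q₃(Ω) = K₂`, `Ker c₃(Ω) = {T₃}` (in the moduli datum: `A₁ = A_y`, `A₂ = A_{y″}`,
`y″ = quotΩ y L`, `A₃ = A_{y‴}`, `y‴ = quotΩ y″ L′ = translΩ y` — [Liu2021] Prop. D.8: two Hecke steps = the central translate —, `K₂ = A_y[𝔭_{c•w}]`, every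
`{Tᵢ} = A[𝔭_w]`), each with its (r3) similitude equations at level `p` and the two degree clauses `deg ψ^∨ = deg ψ` of its legs ([GortzWedhorn2023] Prop. 27.213 (3),
★ (B2)); and the COUNTS `#{T₁} = #{T₂} = #{T₃} = #K₂ = Q = p^k` ([Shimura1998] §7.5: `#A[𝔭](Ω̄) = N𝔭² = q²`).  THEN `#K = Q`: the three roof degree identities (§3)
`#K²·ℓ₂ = Q²·ℓ₁`, `#K″²·ℓ₃ = Q²·ℓ₂`, `Q²·ℓ₃ = Q²·ℓ₁` (`ℓᵢ = #Ker λᵢ(Ω) > 0`, prime to `p` by §2b) and the ℕ-lemma §4.  This is the DEGREE CLAUSE `hdeg` of ★ (ρ2″)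
`isIdealTorsion_mul_of_roof` and the rank row `hrk` of the block assembly, from the datum's three roofs, with no letter and no `ℓ`-chain.
[cite: Liu2021, Prop. D.8 (pp. 135–138)] [cite: MumfordAV1970, §15 Thm. 1 (p. 143); §23 Thm. 2 (p. 231)] [cite: GortzWedhorn2023, Prop. 27.186 and Prop. 27.213 (3)] -/
theorem natCard_eq_of_three_roofs {g : ℕ} (hA₁ : A₁.IsOfRelDim g) (hA₂ : A₂.IsOfRelDim g) (hA₃ : A₃.IsOfRelDim g)
    (D₁ : A₁.DualPair) (pol₁ : A₁.Polarization D₁) (D₂ : A₂.DualPair) (pol₂ : A₂.Polarization D₂) (D₃ : A₃.DualPair) (pol₃ : A₃.Polarization D₃)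
    {p : ℕ} (hp : p.Prime) {k Q : ℕ} (hQ : Q = p ^ k)
    (hν₁ : ∃ (d : ℕ) (ν : D₁.hat.X ⟶ A₁.X), IsMonHom ν ∧ p.Coprime d ∧ pol₁.lam ≫ ν = A₁.mulN d)
    (hν₂ : ∃ (d : ℕ) (ν : D₂.hat.X ⟶ A₂.X), IsMonHom ν ∧ p.Coprime d ∧ pol₂.lam ≫ ν = A₂.mulN d)
    (hν₃ : ∃ (d : ℕ) (ν : D₃.hat.X ⟶ A₃.X), IsMonHom ν ∧ p.Coprime d ∧ pol₃.lam ≫ ν = A₃.mulN d)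
    -- roof₁ : `A₁ —q₁→ B₁ ←c₁— A₂`, `Ker q₁ = K`, `Ker c₁ = {T₁}`
    (DB₁ : B₁.DualPair) (lamB₁ : B₁.X ⟶ DB₁.hat.X) [IsMonHom lamB₁]
    (hDB₁ : Nonempty ((Scheme.Modules.pullback DB₁.unitHatSlice).obj DB₁.P ≅ SheafOfModules.unit _))
    (q₁ : A₁.X ⟶ B₁.X) [IsMonHom q₁] (c₁ : A₂.X ⟶ B₁.X) [IsMonHom c₁]
    (K : Subgroup (A₁.toAffine.toAbelianVariety.Points Ω))
    (h1₁ : ∀ P : A₁.toAffine.toAbelianVariety.Points Ω, (AlgPoints.map q₁ P : B₁.toAffine.toAbelianVariety.Points Ω) = 1 ↔ P ∈ K)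
    (T₁ : A₂.toAffine.toAbelianVariety.Points Ω → Prop)
    (h2₁ : ∀ P : A₂.toAffine.toAbelianVariety.Points Ω, (AlgPoints.map c₁ P : B₁.toAffine.toAbelianVariety.Points Ω) = 1 ↔ T₁ P)
    (h2s₁ : Function.Surjective c₁.left.base)
    (h3₁ : q₁ ≫ lamB₁ ≫ DualPair.dualIsogenyOver q₁ D₁ DB₁ = pol₁.lam ≫ D₁.hat.mulN p)
    (h3₁'' : c₁ ≫ lamB₁ ≫ DualPair.dualIsogenyOver c₁ D₂ DB₁ = pol₂.lam ≫ D₂.hat.mulN p)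
    (hqd₁ : Hom.kerRank (DualPair.dualHom q₁ D₁ DB₁ pol₁.nonempty_unitHatSlice_iso hDB₁) = Hom.kerRank (homOfIsMonHom q₁))
    (hcd₁ : Hom.kerRank (DualPair.dualHom c₁ D₂ DB₁ pol₂.nonempty_unitHatSlice_iso hDB₁) = Hom.kerRank (homOfIsMonHom c₁))
    (hT₁ : Nat.card {P : A₂.toAffine.toAbelianVariety.Points Ω // T₁ P} = Q)
    -- roof₂ : `A₂ —q₂→ B₂ ←c₂— A₃`, `Ker q₂ = K″`, `Ker c₂ = {T₂}`
    (DB₂ : B₂.DualPair) (lamB₂ : B₂.X ⟶ DB₂.hat.X) [IsMonHom lamB₂]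
    (hDB₂ : Nonempty ((Scheme.Modules.pullback DB₂.unitHatSlice).obj DB₂.P ≅ SheafOfModules.unit _))
    (q₂ : A₂.X ⟶ B₂.X) [IsMonHom q₂] (c₂ : A₃.X ⟶ B₂.X) [IsMonHom c₂]
    (K'' : Subgroup (A₂.toAffine.toAbelianVariety.Points Ω))
    (h1₂ : ∀ P : A₂.toAffine.toAbelianVariety.Points Ω, (AlgPoints.map q₂ P : B₂.toAffine.toAbelianVariety.Points Ω) = 1 ↔ P ∈ K'')
    (T₂ : A₃.toAffine.toAbelianVariety.Points Ω → Prop)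
    (h2₂ : ∀ P : A₃.toAffine.toAbelianVariety.Points Ω, (AlgPoints.map c₂ P : B₂.toAffine.toAbelianVariety.Points Ω) = 1 ↔ T₂ P)
    (h2s₂ : Function.Surjective c₂.left.base)
    (h3₂ : q₂ ≫ lamB₂ ≫ DualPair.dualIsogenyOver q₂ D₂ DB₂ = pol₂.lam ≫ D₂.hat.mulN p)
    (h3₂'' : c₂ ≫ lamB₂ ≫ DualPair.dualIsogenyOver c₂ D₃ DB₂ = pol₃.lam ≫ D₃.hat.mulN p)
    (hqd₂ : Hom.kerRank (DualPair.dualHom q₂ D₂ DB₂ pol₂.nonempty_unitHatSlice_iso hDB₂) = Hom.kerRank (homOfIsMonHom q₂))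
    (hcd₂ : Hom.kerRank (DualPair.dualHom c₂ D₃ DB₂ pol₃.nonempty_unitHatSlice_iso hDB₂) = Hom.kerRank (homOfIsMonHom c₂))
    (hT₂ : Nat.card {P : A₃.toAffine.toAbelianVariety.Points Ω // T₂ P} = Q)
    -- roof₃ : `A₁ —q₃→ B₃ ←c₃— A₃`, `Ker q₃ = K₂`, `Ker c₃ = {T₃}`
    (DB₃ : B₃.DualPair) (lamB₃ : B₃.X ⟶ DB₃.hat.X) [IsMonHom lamB₃]
    (hDB₃ : Nonempty ((Scheme.Modules.pullback DB₃.unitHatSlice).obj DB₃.P ≅ SheafOfModules.unit _))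
    (q₃ : A₁.X ⟶ B₃.X) [IsMonHom q₃] (c₃ : A₃.X ⟶ B₃.X) [IsMonHom c₃]
    (K₂ : Subgroup (A₁.toAffine.toAbelianVariety.Points Ω))
    (h1₃ : ∀ P : A₁.toAffine.toAbelianVariety.Points Ω, (AlgPoints.map q₃ P : B₃.toAffine.toAbelianVariety.Points Ω) = 1 ↔ P ∈ K₂)
    (T₃ : A₃.toAffine.toAbelianVariety.Points Ω → Prop)
    (h2₃ : ∀ P : A₃.toAffine.toAbelianVariety.Points Ω, (AlgPoints.map c₃ P : B₃.toAffine.toAbelianVariety.Points Ω) = 1 ↔ T₃ P)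
    (h2s₃ : Function.Surjective c₃.left.base)
    (h3₃ : q₃ ≫ lamB₃ ≫ DualPair.dualIsogenyOver q₃ D₁ DB₃ = pol₁.lam ≫ D₁.hat.mulN p)
    (h3₃'' : c₃ ≫ lamB₃ ≫ DualPair.dualIsogenyOver c₃ D₃ DB₃ = pol₃.lam ≫ D₃.hat.mulN p)
    (hqd₃ : Hom.kerRank (DualPair.dualHom q₃ D₁ DB₃ pol₁.nonempty_unitHatSlice_iso hDB₃) = Hom.kerRank (homOfIsMonHom q₃))
    (hcd₃ : Hom.kerRank (DualPair.dualHom c₃ D₃ DB₃ pol₃.nonempty_unitHatSlice_iso hDB₃) = Hom.kerRank (homOfIsMonHom c₃))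
    (hT₃ : Nat.card {P : A₃.toAffine.toAbelianVariety.Points Ω // T₃ P} = Q)
    (hK₂ : Nat.card ↥K₂ = Q) :
    Nat.card ↥K = Q := by
  haveI := pol₁.isMonHom
  haveI := pol₂.isMonHom
  -- the three roof degree identities
  have e₁ := natCard_sq_mul_eq_of_roof_of_iff_mem hA₁ hA₂ D₁ pol₁ D₂ pol₂ DB₁ lamB₁ hDB₁ q₁ c₁ hp K h1₁ T₁ h2₁ h2s₁ h3₁ h3₁'' hν₁ hν₂ hqd₁ hcd₁
  have e₂ := natCard_sq_mul_eq_of_roof_of_iff_mem hA₂ hA₃ D₂ pol₂ D₃ pol₃ DB₂ lamB₂ hDB₂ q₂ c₂ hp K'' h1₂ T₂ h2₂ h2s₂ h3₂ h3₂'' hν₂ hν₃ hqd₂ hcd₂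
  have e₃ := natCard_sq_mul_eq_of_roof_of_iff_mem hA₁ hA₃ D₁ pol₁ D₃ pol₃ DB₃ lamB₃ hDB₃ q₃ c₃ hp K₂ h1₃ T₃ h2₃ h2s₃ h3₃ h3₃'' hν₁ hν₃ hqd₃ hcd₃
  rw [hT₁] at e₁
  rw [hT₂] at e₂
  rw [hT₃, hK₂] at e₃
  -- positivity and `p`-primality of `#Ker λ₁`, `#Ker λ₂`
  obtain ⟨d₁, ν₁, hνm₁, hcop₁, hν₁'⟩ := hν₁
  obtain ⟨d₂, ν₂, hνm₂, hcop₂, hν₂'⟩ := hν₂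
  haveI := hνm₁
  haveI := hνm₂
  have hd₁ : d₁ ≠ 0 := by rintro rfl; exact hp.ne_one ((Nat.coprime_zero_right p).mp hcop₁)
  have hd₂ : d₂ ≠ 0 := by rintro rfl; exact hp.ne_one ((Nat.coprime_zero_right p).mp hcop₂)
  exact eq_of_three_roof_identities hp hQ (natCard_setOf_map_lam_eq_one_pos D₁ pol₁.lam hd₁ ν₁ hν₁')
    (natCard_setOf_map_lam_eq_one_pos D₂ pol₂.lam hd₂ ν₂ hν₂') (coprime_natCard_setOf_map_lam_eq_one D₁ pol₁.lam hp hcop₁ ν₁ hν₁')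
    (coprime_natCard_setOf_map_lam_eq_one D₂ pol₂.lam hp hcop₂ ν₂ hν₂') e₁ e₂ e₃

end ThreeRoofsHead

/-! ## §6 (ED. 3) The (B2)-fed forms: the degree clauses discharged by ★ `DualPair.kerRank_dualHom_eq` -/

section Fed

variable {Ω : Type u} [Field Ω] [IsAlgClosed Ω] [CharZero Ω] {A A'' B : AbelianSchemeOver (Spec (.of Ω))}

set_option maxHeartbeats 400000 in
/-- **THE TWO DEGREE CLAUSES OF A ROOF'S LEGS** (`Ω = Ω̄`, characteristic `0`): `deg q^∨ = deg q` and `deg c^∨ = deg c` ([GortzWedhorn2023] Prop. 27.213 (3), ★ (B2)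
`DualPair.kerRank_dualHom_eq`), the legs being isogenies by `roof_isogenies`.  [cite: GortzWedhorn2023, Prop. 27.213 (3)] [cite: MumfordAV1970, §15 Thm. 1 (p. 143)] -/
theorem kerRank_dualHom_eq_of_roof {g : ℕ} (hA : A.IsOfRelDim g) (hA'' : A''.IsOfRelDim g)
    (D : A.DualPair) (pol : A.Polarization D) (D'' : A''.DualPair) (pol'' : A''.Polarization D'')
    (DB : B.DualPair) (lamB : B.X ⟶ DB.hat.X) [IsMonHom lamB]
    (hDB : Nonempty ((Scheme.Modules.pullback DB.unitHatSlice).obj DB.P ≅ SheafOfModules.unit _))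
    (q : A.X ⟶ B.X) [IsMonHom q] (c : A''.X ⟶ B.X) [IsMonHom c] {p : ℕ} (hp : p.Prime)
    (h2s : Function.Surjective c.left.base)
    (h3 : q ≫ lamB ≫ DualPair.dualIsogenyOver q D DB = pol.lam ≫ D.hat.mulN p)
    (h3'' : c ≫ lamB ≫ DualPair.dualIsogenyOver c D'' DB = pol''.lam ≫ D''.hat.mulN p)
    (hν : ∃ (d : ℕ) (ν : D.hat.X ⟶ A.X), IsMonHom ν ∧ p.Coprime d ∧ pol.lam ≫ ν = A.mulN d)
    (hν'' : ∃ (d : ℕ) (ν : D''.hat.X ⟶ A''.X), IsMonHom ν ∧ p.Coprime d ∧ pol''.lam ≫ ν = A''.mulN d) :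
    Hom.kerRank (DualPair.dualHom q D DB pol.nonempty_unitHatSlice_iso hDB) = Hom.kerRank (homOfIsMonHom q) ∧
      Hom.kerRank (DualPair.dualHom c D'' DB pol''.nonempty_unitHatSlice_iso hDB) = Hom.kerRank (homOfIsMonHom c) := by
  haveI := pol.isMonHom
  haveI := pol''.isMonHom
  obtain ⟨d, ν, hνm, hcop, hν⟩ := hν
  obtain ⟨d'', ν'', hνm'', hcop'', hν''⟩ := hν''
  haveI := hνm
  haveI := hνm''
  have hp0 : p ≠ 0 := hp.ne_zero
  have hd0 : d ≠ 0 := by rintro rfl; exact hp.ne_one ((Nat.coprime_zero_right p).mp hcop)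
  have hd0'' : d'' ≠ 0 := by rintro rfl; exact hp.ne_one ((Nat.coprime_zero_right p).mp hcop'')
  have hD := pol.nonempty_unitHatSlice_iso
  have hD'' := pol''.nonempty_unitHatSlice_iso
  obtain ⟨hq, hc, -, -, -⟩ := roof_isogenies hA hA'' q c D D'' DB hD hD''
    hDB pol.lam pol''.lam lamB hp0 h2s h3 h3'' (Nat.cast_ne_zero.mpr hd0) ν hν (Nat.cast_ne_zero.mpr hd0'') ν'' hν''
  exact ⟨DualPair.kerRank_dualHom_eq q D DB hD hDB hq, DualPair.kerRank_dualHom_eq c D'' DB hD'' hDB hc⟩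

end Fed

section FedHead

variable {Ω : Type u} [Field Ω] [IsAlgClosed Ω] [CharZero Ω] {A₁ A₂ A₃ B₁ B₂ B₃ : AbelianSchemeOver (Spec (.of Ω))}

set_option maxHeartbeats 400000 in
/-- **THE THREE-ROOF COUNT `#K = Q`, (B2)-FED** — `natCard_eq_of_three_roofs` with its six degree clauses discharged (`kerRank_dualHom_eq_of_roof`); binders: the three
roofs in `RoofΩ` token shapes, the (P-1) rows, the relative dimensions, and the four counts `= Q = p^k`.  THE form the leaf applies.
[cite: Liu2021, Prop. D.8 (pp. 135–138)] [cite: MumfordAV1970, §15 Thm. 1 (p. 143); §23 Thm. 2 (p. 231)] [cite: GortzWedhorn2023, Prop. 27.186 and Prop. 27.213 (3)] -/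
theorem natCard_eq_of_three_roofs' {g : ℕ} (hA₁ : A₁.IsOfRelDim g) (hA₂ : A₂.IsOfRelDim g) (hA₃ : A₃.IsOfRelDim g)
    (D₁ : A₁.DualPair) (pol₁ : A₁.Polarization D₁) (D₂ : A₂.DualPair) (pol₂ : A₂.Polarization D₂) (D₃ : A₃.DualPair) (pol₃ : A₃.Polarization D₃)
    {p : ℕ} (hp : p.Prime) {k Q : ℕ} (hQ : Q = p ^ k)
    (hν₁ : ∃ (d : ℕ) (ν : D₁.hat.X ⟶ A₁.X), IsMonHom ν ∧ p.Coprime d ∧ pol₁.lam ≫ ν = A₁.mulN d)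
    (hν₂ : ∃ (d : ℕ) (ν : D₂.hat.X ⟶ A₂.X), IsMonHom ν ∧ p.Coprime d ∧ pol₂.lam ≫ ν = A₂.mulN d)
    (hν₃ : ∃ (d : ℕ) (ν : D₃.hat.X ⟶ A₃.X), IsMonHom ν ∧ p.Coprime d ∧ pol₃.lam ≫ ν = A₃.mulN d)
    -- roof₁ : `A₁ —q₁→ B₁ ←c₁— A₂`, `Ker q₁ = K`, `Ker c₁ = {T₁}`
    (DB₁ : B₁.DualPair) (lamB₁ : B₁.X ⟶ DB₁.hat.X) [IsMonHom lamB₁]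
    (hDB₁ : Nonempty ((Scheme.Modules.pullback DB₁.unitHatSlice).obj DB₁.P ≅ SheafOfModules.unit _))
    (q₁ : A₁.X ⟶ B₁.X) [IsMonHom q₁] (c₁ : A₂.X ⟶ B₁.X) [IsMonHom c₁]
    (K : Subgroup (A₁.toAffine.toAbelianVariety.Points Ω))
    (h1₁ : ∀ P : A₁.toAffine.toAbelianVariety.Points Ω, (AlgPoints.map q₁ P : B₁.toAffine.toAbelianVariety.Points Ω) = 1 ↔ P ∈ K)
    (T₁ : A₂.toAffine.toAbelianVariety.Points Ω → Prop)
    (h2₁ : ∀ P : A₂.toAffine.toAbelianVariety.Points Ω, (AlgPoints.map c₁ P : B₁.toAffine.toAbelianVariety.Points Ω) = 1 ↔ T₁ P)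
    (h2s₁ : Function.Surjective c₁.left.base)
    (h3₁ : q₁ ≫ lamB₁ ≫ DualPair.dualIsogenyOver q₁ D₁ DB₁ = pol₁.lam ≫ D₁.hat.mulN p)
    (h3₁'' : c₁ ≫ lamB₁ ≫ DualPair.dualIsogenyOver c₁ D₂ DB₁ = pol₂.lam ≫ D₂.hat.mulN p)
    (hT₁ : Nat.card {P : A₂.toAffine.toAbelianVariety.Points Ω // T₁ P} = Q)
    -- roof₂ : `A₂ —q₂→ B₂ ←c₂— A₃`, `Ker q₂ = K″`, `Ker c₂ = {T₂}`
    (DB₂ : B₂.DualPair) (lamB₂ : B₂.X ⟶ DB₂.hat.X) [IsMonHom lamB₂]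
    (hDB₂ : Nonempty ((Scheme.Modules.pullback DB₂.unitHatSlice).obj DB₂.P ≅ SheafOfModules.unit _))
    (q₂ : A₂.X ⟶ B₂.X) [IsMonHom q₂] (c₂ : A₃.X ⟶ B₂.X) [IsMonHom c₂]
    (K'' : Subgroup (A₂.toAffine.toAbelianVariety.Points Ω))
    (h1₂ : ∀ P : A₂.toAffine.toAbelianVariety.Points Ω, (AlgPoints.map q₂ P : B₂.toAffine.toAbelianVariety.Points Ω) = 1 ↔ P ∈ K'')
    (T₂ : A₃.toAffine.toAbelianVariety.Points Ω → Prop)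
    (h2₂ : ∀ P : A₃.toAffine.toAbelianVariety.Points Ω, (AlgPoints.map c₂ P : B₂.toAffine.toAbelianVariety.Points Ω) = 1 ↔ T₂ P)
    (h2s₂ : Function.Surjective c₂.left.base)
    (h3₂ : q₂ ≫ lamB₂ ≫ DualPair.dualIsogenyOver q₂ D₂ DB₂ = pol₂.lam ≫ D₂.hat.mulN p)
    (h3₂'' : c₂ ≫ lamB₂ ≫ DualPair.dualIsogenyOver c₂ D₃ DB₂ = pol₃.lam ≫ D₃.hat.mulN p)
    (hT₂ : Nat.card {P : A₃.toAffine.toAbelianVariety.Points Ω // T₂ P} = Q)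
    -- roof₃ : `A₁ —q₃→ B₃ ←c₃— A₃`, `Ker q₃ = K₂`, `Ker c₃ = {T₃}`
    (DB₃ : B₃.DualPair) (lamB₃ : B₃.X ⟶ DB₃.hat.X) [IsMonHom lamB₃]
    (hDB₃ : Nonempty ((Scheme.Modules.pullback DB₃.unitHatSlice).obj DB₃.P ≅ SheafOfModules.unit _))
    (q₃ : A₁.X ⟶ B₃.X) [IsMonHom q₃] (c₃ : A₃.X ⟶ B₃.X) [IsMonHom c₃]
    (K₂ : Subgroup (A₁.toAffine.toAbelianVariety.Points Ω))
    (h1₃ : ∀ P : A₁.toAffine.toAbelianVariety.Points Ω, (AlgPoints.map q₃ P : B₃.toAffine.toAbelianVariety.Points Ω) = 1 ↔ P ∈ K₂)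
    (T₃ : A₃.toAffine.toAbelianVariety.Points Ω → Prop)
    (h2₃ : ∀ P : A₃.toAffine.toAbelianVariety.Points Ω, (AlgPoints.map c₃ P : B₃.toAffine.toAbelianVariety.Points Ω) = 1 ↔ T₃ P)
    (h2s₃ : Function.Surjective c₃.left.base)
    (h3₃ : q₃ ≫ lamB₃ ≫ DualPair.dualIsogenyOver q₃ D₁ DB₃ = pol₁.lam ≫ D₁.hat.mulN p)
    (h3₃'' : c₃ ≫ lamB₃ ≫ DualPair.dualIsogenyOver c₃ D₃ DB₃ = pol₃.lam ≫ D₃.hat.mulN p)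
    (hT₃ : Nat.card {P : A₃.toAffine.toAbelianVariety.Points Ω // T₃ P} = Q)
    (hK₂ : Nat.card ↥K₂ = Q) :
    Nat.card ↥K = Q := by
  obtain ⟨hqd₁, hcd₁⟩ := kerRank_dualHom_eq_of_roof hA₁ hA₂ D₁ pol₁ D₂ pol₂ DB₁ lamB₁ hDB₁ q₁ c₁ hp h2s₁ h3₁ h3₁'' hν₁ hν₂
  obtain ⟨hqd₂, hcd₂⟩ := kerRank_dualHom_eq_of_roof hA₂ hA₃ D₂ pol₂ D₃ pol₃ DB₂ lamB₂ hDB₂ q₂ c₂ hp h2s₂ h3₂ h3₂'' hν₂ hν₃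
  obtain ⟨hqd₃, hcd₃⟩ := kerRank_dualHom_eq_of_roof hA₁ hA₃ D₁ pol₁ D₃ pol₃ DB₃ lamB₃ hDB₃ q₃ c₃ hp h2s₃ h3₃ h3₃'' hν₁ hν₃
  exact natCard_eq_of_three_roofs hA₁ hA₂ hA₃ D₁ pol₁ D₂ pol₂ D₃ pol₃ hp hQ hν₁ hν₂ hν₃
    DB₁ lamB₁ hDB₁ q₁ c₁ K h1₁ T₁ h2₁ h2s₁ h3₁ h3₁'' hqd₁ hcd₁ hT₁
    DB₂ lamB₂ hDB₂ q₂ c₂ K'' h1₂ T₂ h2₂ h2s₂ h3₂ h3₂'' hqd₂ hcd₂ hT₂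
    DB₃ lamB₃ hDB₃ q₃ c₃ K₂ h1₃ T₃ h2₃ h2s₃ h3₃ h3₃'' hqd₃ hcd₃ hT₃ hK₂

end FedHead

end AbelianSchemeOver

end Literature.AlgebraicGeometry.AbelianSchemes

end
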